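import Literature.MathematicalPhysics.KineticTheory.FouriersLaw
import Mathlib.Analysis.Fourier.AddCircle
import Mathlib.MeasureTheory.Integral.Prod
import Mathlib.Analysis.Calculus.Deriv.Shift
import HarnessLib

/-!
# Time-periodic (Floquet) steady states of the boundary-modulated oscillator chain and their
first-order AC response

Topic `Literature/MathematicalPhysics/KineticTheory`; definition request
`defn-FloquetSteadyStateResponse` (route `AtomisticToContinuum/FouriersLaw/PuiseuxTransfer`,
foreseen layer-2 statements `TwistedTransferGap` / `PuiseuxContinuation` of the crux
`TwoModeBulk`). Everything is stated for a general `OscillatorChain P` of `FouriersLaw.lean`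
(`PhaseSpace N`, `P.generator N T_L T_R`, `P.bondCurrent N i`, `P.IsSteadyState N T_L T_R μ`).

## The object

Drive the LEFT Langevin bath of the `N`-site chain with a time-periodic temperature
`T_L(t) = T + a cos (Ω t)`, keep `T_R = T`. The process `(q_t, p_t)` is then a time-inhomogeneous
diffusion with `2π/Ω`-periodic generator `L_t = P.generator N (T_L t) T`; adjoining the phase clock
`φ_t = Ω t (mod 2π)` makes `(q_t, p_t, φ_t)` a time-HOMOGENEOUS Markov process on the extended
phase space `PhaseSpace N × (ℝ / 2πℤ)` with generator (skew product over the uniform rotation)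

  `𝓛 f (x, φ) = Ω ∂_φ f (x, φ) + (L_{T_L(φ), T_R(φ)} f(·, φ)) (x)`.

A TIME-PERIODIC (Floquet, "oscillating") steady state of the modulated chain is a stationary law
of this skew product: a probability measure `μ` on `PhaseSpace N × AddCircle (2π)` solving the
stationary Kolmogorov/Fokker–Planck equation WEAKLY,

  `∫ (Ω ∂_φ f + L_{T_L(φ),T_R(φ)} f(·, φ)) dμ = 0` for all smooth compactly supported `f (x, φ)`,

exactly parallel to `OscillatorChain.IsSteadyState` (which is the case of phase-independent data
tested on phase-independent `f`). Disintegrating `μ(dx dφ) = μ_φ(dx) dφ/2π` (for `Ω ≠ 0` the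
phase marginal of a solution is the uniform measure, formally: test `f = h(φ) χ_R(x)`), the family
`t ↦ μ_{Ω t}` is a `2π/Ω`-periodic measure-valued solution of the Fokker–Planck equation
`∂_t μ_t = L_t^* μ_t`, i.e. a PERIODIC MEASURE of the time-periodic diffusion in the sense of
Feng–Zhao–Zhong (2023), whose Theorem 5.2 characterises periodic measures with a `C^{1,2}`
density `q` exactly by `∂_t q = L^*(t) q, q(0, ·) = q(T, ·)` and which notes that "an invariant
measure can be obtained by lifting the periodic measure on a cylinder" (§1); the weak equation
above is that lifted (cylinder) formulation, stated distributionally so that no density or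
semigroup is needed. In the physics literature these are the asymptotic time-periodic solutions
of periodically driven Fokker–Planck equations (P. Jung, *Periodically driven stochastic systems*,
Phys. Rep. 234 (1993); for periodically modulated noise strength = bath temperature of underdamped
Langevin dynamics: Awasthi–Dutta 2021, §2.1, "oscillating states").

## The AC response (Dhar–Narayan–Kundu–Saito 2011, §II)

For bath temperatures oscillating as `T ± ΔT(t)/2`, `ΔT(t) = ΔT(ω) e^{iωt}`, linear response
about the equilibrium state gives for every phase-space observable `A` (they display the bond
current `j_{l+1,l}`) a complex response `⟨A(ω)⟩ / ΔT(ω) = G(ω) e^{-iφ(ω)}` depending on the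
position `l` in the chain ("the current response depends on `l` … as one would expect"; for
`ω ≠ 0` one may "treat `ΔT_L` and `ΔT_R` as independent variables"). In the Floquet state `μ_a`
of the real protocol `T_L = T + a cos φ` the first-order part of `φ ↦ μ_{a,φ}(A)` is
`a · Re (χ_A(Ω) e^{iφ})`, so its first Fourier mode is `∫ A e^{-iφ} dμ_a = (a/2) χ_A(Ω) + o(a)`:
the objects below record the complex first Fourier mode in the phase of an observable under `μ`
(`phaseMode`), its instances for the kinetic temperature `p_i²` (`kineticTemperatureMode`) and
the bond current (`OscillatorChain.bondCurrentMode`), and the first-order response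
`Θ = lim_{a → 0, a ≠ 0} (mode under μ_a) / a` along a family `a ↦ μ_a` (`HasACResponse`), which
is `χ_A(Ω)/2` in the notation of DNKS. The route's `Θ_N(i; ω)` is any `Θ` with
`HasACResponse (kineticTemperatureMode N i) μ Θ` for a family of Floquet states
`∀ a, P.IsFloquetSteadyState N ω T a (μ a)`.

## Contents

* `PhaseCircle = AddCircle (2π)`, `FloquetPhaseSpace N = PhaseSpace N × PhaseCircle`,
  `PhaseCircle.cos` (the modulation profile), `phaseHaar` (uniform phase `dφ/2π`),
  `phaseDeriv` (`∂_φ`).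
* `OscillatorChain.floquetGenerator P N Ω T_L T_R f` — the skew-product generator for arbitrary
  phase-dependent bath temperatures `T_L T_R : PhaseCircle → ℝ`.
* `OscillatorChain.IsPeriodicSteadyState P N Ω T_L T_R μ` — weak stationary law of the skew
  product, bond currents and `p_i²` integrable; `OscillatorChain.IsFloquetSteadyState P N Ω T a μ`
  — the requested instance `T_L = T + a cos φ`, `T_R = T`.
* `phaseMode`, `kineticTemperatureMode`, `OscillatorChain.bondCurrentMode`, `HasACResponse`.
* API: unfolding lemmas; `floquetGenerator` on phase-independent / space-independent test
  functions; `∫ e^{-iφ} dφ/2π = 0` and the vanishing of every `phaseMode` on a product state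
  `ν ⊗ Haar` (so the response quotient needs no subtraction at `a = 0`); the fundamental theorem
  of calculus on the phase circle `∫ ∂_φ g dφ = 0`; the `N = 0` witness
  `δ ⊗ Haar` (non-vacuity for every `Ω, T_L, T_R`).
* Reduction at `a = 0` / `Ω = 0` (section `Reduction`, proved for an arbitrary chain `P`):
  `OscillatorChain.IsSteadyState.prod_phaseHaar` (steady state with `p_i²` integrable ⊗ `dφ/2π`
  is a periodic steady state with constant temperatures, every `Ω`;
  `isFloquetSteadyState_prod_phaseHaar` for `IsFloquetSteadyState N Ω T 0`),
  `OscillatorChain.IsSteadyState.prod_of_frozen` (`Ω = 0`: `⊗` any phase law),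
  `OscillatorChain.IsPeriodicSteadyState.isSteadyState_map_fst` (the phase-space marginal of a
  periodic steady state with constant temperatures is a steady state;
  `IsFloquetSteadyState.isSteadyState_map_fst` at `a = 0`).

## Design choices

* Phase on `AddCircle (2π)` (not `ℝ` with periodic test functions): a probability measure on the
  compact phase factor, so that uniqueness statements make sense; `φ = Ω t mod 2π` keeps the
  requester's normalisation `Ω ∂_φ`, `e^{-iφ} = fourier (-1)`.
* Smoothness of a test function `f` on `PhaseSpace N × AddCircle (2π)` means smoothness of its
  lift `(x, s) ↦ f (x, ↑s)` to the vector space `PhaseSpace N × ℝ`; compact support is taken in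
  the product (the circle being compact, this is compact support in `x` uniformly in `φ`).
* `∂_φ` and the `∂_{q_i}, ∂_{p_i}` inside `P.generator` are one-variable `deriv`s (junk `0` where
  not differentiable), as in `FouriersLaw.lean`; the weak equation does not ask integrability of
  `𝓛 f` (Bochner junk `0` otherwise), exactly as `IsSteadyState` — for `C¹` potentials and the
  test functions used, `𝓛 f` is continuous with compact support.
* Besides the bond currents (as in `IsSteadyState`) the kinetic temperatures `p_i²` are required
  to be integrable (requested: the AC temperature profile is an honest expectation). Consequently
  at `a = 0` the Floquet states with constant data are the products "(`IsSteadyState` with `p_i²`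
  integrable) ⊗ anything" only formally; what IS immediate is recorded: phase modes of product
  states vanish (`phaseMode_prod_phaseHaar`), and `Ω ∂_φ` integrates to zero against Haar
  (`PhaseCircle.integral_deriv_eq_zero`). The full statement "`P.IsSteadyState N T T ν`, `p_i²`
  integrable ⇒ `P.IsFloquetSteadyState N Ω T 0 (ν ⊗ phaseHaar)`" and its converse on marginals
  are proved in section `Reduction` WITHOUT regularity of the potentials (the clock term is
  continuous with compact support; the chain term is handled fibrewise by Fubini when integrable
  and by the Bochner convention otherwise); existence and uniqueness of
  Floquet states for `pinnedChain` (Harris theory for time-periodic hypoelliptic diffusions) are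
  separate statements, not part of the definition (requester's design note).
* `Ω = 0` is allowed and degenerate (frozen phase: `μ` is then a mixture over `φ` of steady states
  at the frozen temperatures); `a` may have any sign; no positivity of `T` is built in.
* Mathlib has no global `Fact (0 < 2π)` instance; `phaseHaar` packages `haarAddCircle` with it
  (`phaseHaar_eq`). The binder for the drive frequency is `Ω` because `ω` is notation under
  `open scoped ContDiff`.
* Searched (`lean search`): `Floquet`, `time-periodic`, `skew product`, `IsSteadyState`,
  `generator N` — no time-periodic steady states of diffusions in Mathlib or Literature.
-/

noncomputable section

open MeasureTheory Filter
open scoped ContDiff Topology Real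

namespace Literature.MathematicalPhysics.KineticTheory.HeatConduction

/-! ### The phase clock -/

/-- The phase clock of the modulation: the circle `ℝ / 2πℤ` carrying `φ = Ω t mod 2π`.
[folklore] -/
abbrev PhaseCircle : Type := AddCircle (2 * π)

/-- Extended phase space of the modulated `N`-chain: `(q, p, φ) ∈ PhaseSpace N × (ℝ / 2πℤ)`
(the "cylinder" on which a periodic measure lifts to an invariant one).
[Feng–Zhao–Zhong 2023, §1] [cite: FengZhaoZhong2023, §1] -/
abbrev FloquetPhaseSpace (N : ℕ) : Type := PhaseSpace N × PhaseCircle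

/-- The cosine on the phase circle, `cos φ` (well defined by `2π`-periodicity): the profile of the
temperature modulation `T_L = T + a cos φ`. [folklore] -/
def PhaseCircle.cos : PhaseCircle → ℝ := Real.cos_periodic.lift

/-- `PhaseCircle.cos ↑φ = cos φ`. [folklore] -/
@[simp] theorem PhaseCircle.cos_coe (φ : ℝ) : PhaseCircle.cos (φ : PhaseCircle) = Real.cos φ :=
  rfl

/-- The uniform probability measure `dφ/2π` on the phase circle (Mathlib's normalised Haar
measure `haarAddCircle`, with the instance `Fact (0 < 2π)` supplied). [folklore] -/
def phaseHaar : Measure PhaseCircle := @AddCircle.haarAddCircle (2 * π) ⟨Real.two_pi_pos⟩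

/-- `phaseHaar` is `haarAddCircle` (for any instance of `Fact (0 < 2π)`). [folklore] -/
theorem phaseHaar_eq [Fact (0 < 2 * π)] : phaseHaar = AddCircle.haarAddCircle := rfl

/-- `dφ/2π` is a probability measure. [folklore] -/
instance isProbabilityMeasure_phaseHaar : IsProbabilityMeasure phaseHaar := by
  haveI : Fact (0 < 2 * π) := ⟨Real.two_pi_pos⟩
  rw [phaseHaar_eq]; infer_instance

/-- The phase derivative `∂_φ f (x, φ) = d/dt f (x, φ + t) |_{t=0}` of a function on the extended
phase space (one-variable `deriv`, junk `0` where not differentiable). [folklore] -/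
def phaseDeriv {N : ℕ} (f : FloquetPhaseSpace N → ℝ) (z : FloquetPhaseSpace N) : ℝ :=
  deriv (fun t : ℝ => f (z.1, z.2 + (t : PhaseCircle))) 0

/-- On representatives, `∂_φ f (x, ↑φ)` is the derivative of the lift `s ↦ f (x, ↑s)` at `φ`.
[folklore] -/
theorem phaseDeriv_coe {N : ℕ} (f : FloquetPhaseSpace N → ℝ) (x : PhaseSpace N) (φ : ℝ) :
    phaseDeriv f (x, (φ : PhaseCircle)) = deriv (fun s : ℝ => f (x, (s : PhaseCircle))) φ := by
  unfold phaseDeriv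
  have h : (fun t : ℝ => f (x, (φ : PhaseCircle) + (t : PhaseCircle))) =
      fun t => (fun s : ℝ => f (x, (s : PhaseCircle))) (φ + t) := by
    funext t
    rw [← AddCircle.coe_add]
  rw [h, deriv_comp_const_add (fun s : ℝ => f (x, (s : PhaseCircle))) φ 0, add_zero]

/-! ### Periodic (Floquet) steady states -/

namespace OscillatorChain

variable (P : OscillatorChain)

/-- The generator of the skew product "modulated chain × phase clock" on the extended phase
space: `𝓛 f (x, φ) = Ω ∂_φ f (x, φ) + (L_{T_L(φ), T_R(φ)} f(·, φ)) (x)`, where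
`L_{T_L, T_R} = P.generator N T_L T_R` is the Langevin-chain generator of `FouriersLaw.lean` with
the instantaneous bath temperatures `T_L(φ), T_R(φ)` and `Ω` is the angular frequency of the
drive (`φ = Ω t`). Its formal adjoint equation `𝓛* μ = 0` is the time-periodic Fokker–Planck
equation `∂_t q = L^*(t) q`, `q(0, ·) = q(period, ·)` written on the cylinder.
[Feng–Zhao–Zhong 2023, §5 Thm 5.2 (time-periodic Fokker–Planck equation of a periodic measure),
§1 (lift to the cylinder)] [cite: FengZhaoZhong2023, Thm 5.2] -/
def floquetGenerator (N : ℕ) (Ω : ℝ) (T_L T_R : PhaseCircle → ℝ)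
    (f : FloquetPhaseSpace N → ℝ) (z : FloquetPhaseSpace N) : ℝ :=
  Ω * phaseDeriv f z + P.generator N (T_L z.2) (T_R z.2) (fun x => f (x, z.2)) z.1

/-- `P.IsPeriodicSteadyState N Ω T_L T_R μ`: `μ` is a time-periodic (Floquet) steady state of the
`N`-site chain driven by Langevin baths whose temperatures `T_L(φ), T_R(φ)` depend on the phase
`φ = Ω t mod 2π` of a drive of angular frequency `Ω` — i.e. a stationary law of the skew product
on `PhaseSpace N × (ℝ/2πℤ)`: a probability measure solving the stationary Kolmogorov equation
weakly, `∫ (Ω ∂_φ f + L_{T_L(φ),T_R(φ)} f(·,φ)) dμ = 0` for every test function `f` whose lift to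
`PhaseSpace N × ℝ` is smooth and which has compact support, and under which the bond currents
and the kinetic temperatures `p_i²` are integrable. Disintegrated over the (uniform) phase,
`t ↦ μ_{Ωt}` is a periodic measure of the time-periodic diffusion, cf. Feng–Zhao–Zhong 2023,
Thm 5.2: a `C^{1,2}` density defines a periodic measure iff `∂_t q = L^*(t) q, q(0,·) = q(T,·)`.
The time-periodic analogue of `OscillatorChain.IsSteadyState`.
[Feng–Zhao–Zhong 2023, §3 (periodic measures of time-periodic Markovian systems), Thm 5.2]
[cite: FengZhaoZhong2023, Thm 5.2] -/
def IsPeriodicSteadyState (N : ℕ) (Ω : ℝ) (T_L T_R : PhaseCircle → ℝ)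
    (μ : Measure (FloquetPhaseSpace N)) : Prop :=
  IsProbabilityMeasure μ ∧
    (∀ f : FloquetPhaseSpace N → ℝ,
        ContDiff ℝ ∞ (fun y : PhaseSpace N × ℝ => f (y.1, (y.2 : PhaseCircle))) →
        HasCompactSupport f → ∫ z, P.floquetGenerator N Ω T_L T_R f z ∂μ = 0) ∧
    (∀ i : Fin N, Integrable (fun z : FloquetPhaseSpace N => P.bondCurrent N i z.1) μ) ∧
    ∀ i : Fin N, Integrable (fun z : FloquetPhaseSpace N => z.1.2 i ^ 2) μ

/-- `P.IsFloquetSteadyState N Ω T a μ`: `μ` is a Floquet (time-periodic) steady state of the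
`N`-site chain whose LEFT bath temperature is modulated harmonically in time,
`T_L(t) = T + a cos (Ω t)`, the right bath staying at `T` — the instance
`T_L(φ) = T + a cos φ`, `T_R(φ) = T` of `IsPeriodicSteadyState` (oscillating bath temperatures as
in the finite-frequency linear-response set-up of Dhar–Narayan–Kundu–Saito, who perturb
`T_{L,R} = T ± ΔT(t)/2` and note that `ΔT_L`, `ΔT_R` may be treated independently at `ω ≠ 0`).
[Dhar–Narayan–Kundu–Saito 2011, §II; Awasthi–Dutta 2021, §2.1 (periodically modulated noise
strength)] [cite: DharEtAl2011, §II] -/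
def IsFloquetSteadyState (N : ℕ) (Ω T a : ℝ) (μ : Measure (FloquetPhaseSpace N)) : Prop :=
  P.IsPeriodicSteadyState N Ω (fun θ => T + a * PhaseCircle.cos θ) (fun _ => T) μ

end OscillatorChain

/-! ### First Fourier modes in the phase and the first-order AC response -/

/-- The complex first Fourier mode in the phase of a phase-space observable `g` under a law `μ`
on the extended phase space: `∫ g(x) e^{-iφ} dμ(x, φ)` (`e^{-iφ} = fourier (-1)` on
`AddCircle (2π)`). For a Floquet state `μ(dx dφ) = μ_φ(dx) dφ/2π` this is the first Fourier
coefficient of the periodic signal `φ ↦ μ_φ(g)`, the quantity whose ratio to the modulation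
amplitude is the finite-frequency response `G(ω) e^{-iφ(ω)}` of DNKS ("expressions similar …
can be obtained for any quantity that depends on the phase space variables of the system").
[Dhar–Narayan–Kundu–Saito 2011, §II] [cite: DharEtAl2011, §II] -/
def phaseMode {N : ℕ} (g : PhaseSpace N → ℝ) (μ : Measure (FloquetPhaseSpace N)) : ℂ :=
  ∫ z, (g z.1 : ℂ) * fourier (-1) z.2 ∂μ

/-- The first Fourier mode in the phase of the kinetic temperature `p_i²` of site `i`:
`∫ p_i² e^{-iφ} dμ` — the AC temperature profile entering the route's `Θ_N(i; ω)`.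
[Dhar–Narayan–Kundu–Saito 2011, §II (response of a general phase-space observable)]
[cite: DharEtAl2011, §II] -/
def kineticTemperatureMode (N : ℕ) (i : Fin N) (μ : Measure (FloquetPhaseSpace N)) : ℂ :=
  phaseMode (fun x : PhaseSpace N => x.2 i ^ 2) μ

/-- The first Fourier mode in the phase of the bond energy current `j_i = P.bondCurrent N i`
through the bond `(i, i+1)`: `∫ j_i e^{-iφ} dμ` — the numerator of the finite-frequency thermal
conductance `⟨j_{l+1,l}(ω)⟩ / ΔT(ω) = G_l(ω) e^{-iφ_l(ω)}`.
[Dhar–Narayan–Kundu–Saito 2011, §II] [cite: DharEtAl2011, §II] -/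
def OscillatorChain.bondCurrentMode (P : OscillatorChain) (N : ℕ) (i : Fin N)
    (μ : Measure (FloquetPhaseSpace N)) : ℂ :=
  phaseMode (P.bondCurrent N i) μ

/-- `HasACResponse F μ Θ`: along the family of laws `a ↦ μ a` (the Floquet states at modulation
amplitude `a`), the complex functional `F` (a phase mode) has the FIRST-ORDER RESPONSE `Θ`:
`F (μ a) / a → Θ` as `a → 0`, `a ≠ 0` (linear response per unit modulation amplitude; no
subtraction at `a = 0` is needed for phase modes, which vanish on phase-independent product
states, `phaseMode_prod_phaseHaar`). For the cosine protocol `a cos φ = (a/2)(e^{iφ} + e^{-iφ})`,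
`Θ = χ(Ω)/2` where `χ = G e^{-iφ}` is the complex susceptibility `⟨A(ω)⟩/ΔT(ω)` of DNKS. The
route's AC temperature profile `Θ_N(i; ω)` is a `Θ` with
`HasACResponse (kineticTemperatureMode N i) μ Θ` for a family with
`∀ a, P.IsFloquetSteadyState N ω T a (μ a)`; likewise `P.bondCurrentMode N i` for the AC
conductances. [Dhar–Narayan–Kundu–Saito 2011, §II (linear response to `ΔT(ω) e^{iωt}`)]
[cite: DharEtAl2011, §II] -/
def HasACResponse {N : ℕ} (F : Measure (FloquetPhaseSpace N) → ℂ)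
    (μ : ℝ → Measure (FloquetPhaseSpace N)) (Θ : ℂ) : Prop :=
  Tendsto (fun a : ℝ => F (μ a) / (a : ℂ)) (𝓝[≠] 0) (𝓝 Θ)

/-! ### API -/

namespace OscillatorChain

variable (P : OscillatorChain)

/-- Unfolding `IsFloquetSteadyState`: the left bath follows `T + a cos φ`, the right one `T`.
[folklore] -/
theorem isFloquetSteadyState_iff (N : ℕ) (Ω T a : ℝ) (μ : Measure (FloquetPhaseSpace N)) :
    P.IsFloquetSteadyState N Ω T a μ ↔
      P.IsPeriodicSteadyState N Ω (fun θ => T + a * PhaseCircle.cos θ) (fun _ => T) μ :=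
  Iff.rfl

/-- At zero amplitude the data are the constant temperatures `T, T`. [folklore] -/
theorem isFloquetSteadyState_zero_iff (N : ℕ) (Ω T : ℝ) (μ : Measure (FloquetPhaseSpace N)) :
    P.IsFloquetSteadyState N Ω T 0 μ ↔ P.IsPeriodicSteadyState N Ω (fun _ => T) (fun _ => T) μ := by
  simp only [IsFloquetSteadyState, zero_mul, add_zero]

/-- Unfolding the weak equation of a periodic steady state. [folklore] -/
theorem IsPeriodicSteadyState.integral_floquetGenerator {P : OscillatorChain} {N : ℕ} {Ω : ℝ}
    {T_L T_R : PhaseCircle → ℝ} {μ : Measure (FloquetPhaseSpace N)}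
    (h : P.IsPeriodicSteadyState N Ω T_L T_R μ) {f : FloquetPhaseSpace N → ℝ}
    (hf : ContDiff ℝ ∞ (fun y : PhaseSpace N × ℝ => f (y.1, (y.2 : PhaseCircle))))
    (hfc : HasCompactSupport f) : ∫ z, P.floquetGenerator N Ω T_L T_R f z ∂μ = 0 :=
  h.2.1 f hf hfc

/-- A periodic steady state is a probability measure. [folklore] -/
theorem IsPeriodicSteadyState.isProbabilityMeasure {P : OscillatorChain} {N : ℕ} {Ω : ℝ}
    {T_L T_R : PhaseCircle → ℝ} {μ : Measure (FloquetPhaseSpace N)}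
    (h : P.IsPeriodicSteadyState N Ω T_L T_R μ) : IsProbabilityMeasure μ :=
  h.1

/-- On a phase-independent test function `f (x, φ) = g x` the skew-product generator is the chain
generator with the instantaneous temperatures (the clock term `Ω ∂_φ` vanishes). [folklore] -/
theorem floquetGenerator_comp_fst (N : ℕ) (Ω : ℝ) (T_L T_R : PhaseCircle → ℝ)
    (g : PhaseSpace N → ℝ) (z : FloquetPhaseSpace N) :
    P.floquetGenerator N Ω T_L T_R (fun z => g z.1) z = P.generator N (T_L z.2) (T_R z.2) g z.1 := by
  simp [floquetGenerator, phaseDeriv]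

/-- On a phase-only test function `f (x, φ) = h φ` the skew-product generator is the clock
`Ω ∂_φ h` (the chain generator annihilates functions constant in `x`). [folklore] -/
theorem floquetGenerator_comp_snd (N : ℕ) (Ω : ℝ) (T_L T_R : PhaseCircle → ℝ)
    (h : PhaseCircle → ℝ) (z : FloquetPhaseSpace N) :
    P.floquetGenerator N Ω T_L T_R (fun z => h z.2) z =
      Ω * deriv (fun t : ℝ => h (z.2 + (t : PhaseCircle))) 0 := by
  simp [floquetGenerator, phaseDeriv]

end OscillatorChain

/-- `∫ e^{-iφ} dφ/2π = 0`. [folklore] -/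
theorem integral_fourier_neg_one_phaseHaar : ∫ θ, fourier (-1) θ ∂phaseHaar = 0 := by
  haveI : Fact (0 < 2 * π) := ⟨Real.two_pi_pos⟩
  rw [phaseHaar_eq]
  exact integral_eq_zero_of_add_right_eq_neg
    (fourier_add_half_inv_index (by norm_num) Real.two_pi_pos)

/-- Every phase mode of a phase-independent product state `ν ⊗ dφ/2π` vanishes: at zero
modulation amplitude (product reference state) there is nothing to subtract in the response
quotient `phaseMode g (μ a) / a`. [folklore] -/
theorem phaseMode_prod_phaseHaar {N : ℕ} (g : PhaseSpace N → ℝ) (ν : Measure (PhaseSpace N))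
    [SFinite ν] : phaseMode g (ν.prod phaseHaar) = 0 := by
  unfold phaseMode
  rw [integral_prod_mul (fun x : PhaseSpace N => (g x : ℂ)) (fun θ : PhaseCircle => fourier (-1) θ),
    integral_fourier_neg_one_phaseHaar, mul_zero]

/-- In particular the AC kinetic-temperature modes of a product state vanish. [folklore] -/
theorem kineticTemperatureMode_prod_phaseHaar {N : ℕ} (i : Fin N) (ν : Measure (PhaseSpace N))
    [SFinite ν] : kineticTemperatureMode N i (ν.prod phaseHaar) = 0 :=
  phaseMode_prod_phaseHaar _ ν

/-- Fundamental theorem of calculus on the phase circle: for `g` with a `C¹` lift,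
`∫ ∂_φ g dφ/2π = 0` — the clock term `Ω ∂_φ` is formally skew-adjoint with respect to the uniform
phase measure, which is why the phase marginal of a Floquet state is uniform. [folklore] -/
theorem PhaseCircle.integral_deriv_eq_zero {g : PhaseCircle → ℝ}
    (hg : ContDiff ℝ 1 (fun s : ℝ => g (s : PhaseCircle))) :
    ∫ θ, deriv (fun t : ℝ => g (θ + (t : PhaseCircle))) 0 ∂phaseHaar = 0 := by
  haveI : Fact (0 < 2 * π) := ⟨Real.two_pi_pos⟩
  set G : ℝ → ℝ := fun s => g (s : PhaseCircle) with hG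
  set D : PhaseCircle → ℝ := fun θ => deriv (fun t : ℝ => g (θ + (t : PhaseCircle))) 0 with hD
  have hDG : ∀ s : ℝ, D (s : PhaseCircle) = deriv G s := by
    intro s
    have h : (fun t : ℝ => g ((s : PhaseCircle) + (t : PhaseCircle))) = fun t => G (s + t) := by
      funext t
      rw [← AddCircle.coe_add]
    simp only [hD, h]
    rw [deriv_comp_const_add G s 0, add_zero]
  have hvol : ∫ θ, D θ ∂(volume : Measure PhaseCircle) = 0 := by
    rw [← AddCircle.intervalIntegral_preimage (2 * π) 0 D]
    simp only [hDG, zero_add]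
    rw [intervalIntegral.integral_deriv_eq_sub (fun x _ => (hg.differentiable one_ne_zero) x)
      ((hg.continuous_deriv le_rfl).intervalIntegrable _ _)]
    simp only [hG, AddCircle.coe_period, QuotientAddGroup.mk_zero, sub_self]
  have hsmul : (volume : Measure PhaseCircle) = ENNReal.ofReal (2 * π) • phaseHaar := by
    rw [phaseHaar_eq]; exact AddCircle.volume_eq_smul_haarAddCircle
  rw [hsmul, integral_smul_measure, ENNReal.toReal_ofReal Real.two_pi_pos.le, smul_eq_mul,
    mul_eq_zero] at hvol
  exact hvol.resolve_left Real.two_pi_pos.ne'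

/-- Non-vacuity for every drive: the empty chain (`N = 0`, phase space a point, no bonds) has the
Floquet state `δ ⊗ dφ/2π` for all `Ω, T_L, T_R` — the chain part of the generator vanishes and the
clock term integrates to zero over the uniform phase (FTC on the circle). The time-periodic
analogue of `OscillatorChain.isSteadyState_zero`. [folklore] -/
theorem OscillatorChain.isPeriodicSteadyState_zero (P : OscillatorChain) (Ω : ℝ)
    (T_L T_R : PhaseCircle → ℝ) :
    P.IsPeriodicSteadyState 0 Ω T_L T_R ((Measure.dirac default).prod phaseHaar) := by
  refine ⟨inferInstance, ?_, fun i => i.elim0, fun i => i.elim0⟩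
  intro f hf _
  have hgen : ∀ z : FloquetPhaseSpace 0,
      P.floquetGenerator 0 Ω T_L T_R f z = Ω * phaseDeriv f z := by
    intro z
    simp [OscillatorChain.floquetGenerator, OscillatorChain.generator]
  simp_rw [hgen]
  have hf1 : ContDiff ℝ 1 (fun s : ℝ => f (default, (s : PhaseCircle))) :=
    (hf.of_le (by norm_cast)).comp (contDiff_const.prodMk contDiff_id)
  have hemb : MeasurableEmbedding
      (Prod.mk (default : PhaseSpace 0) : PhaseCircle → FloquetPhaseSpace 0) :=
    MeasurableEmbedding.prodMk_left default MeasurableEmbedding.id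
  rw [integral_const_mul, Measure.dirac_prod, hemb.integral_map]
  have key := PhaseCircle.integral_deriv_eq_zero (g := fun θ => f (default, θ)) hf1
  simp only [phaseDeriv] at key ⊢
  rw [key, mul_zero]

/-- Hence also a Floquet state of the empty chain for the cosine protocol, every `Ω, T, a`.
[folklore] -/
theorem OscillatorChain.isFloquetSteadyState_zero (P : OscillatorChain) (Ω T a : ℝ) :
    P.IsFloquetSteadyState 0 Ω T a ((Measure.dirac default).prod phaseHaar) :=
  P.isPeriodicSteadyState_zero Ω _ _

/-! ### Reduction at zero modulation amplitude (`a = 0`) and at frozen phase (`Ω = 0`)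

The consistency requirement of the definition request — with constant bath temperatures the
Floquet states must reduce to "steady state ⊗ (uniform) phase" — as theorems, for an ARBITRARY
chain `P` (no regularity of `U, V` is used):

* `OscillatorChain.IsSteadyState.prod_phaseHaar`: if `ν` is a steady state at `T_L, T_R` under
  which the `p_i²` are integrable, then `ν ⊗ dφ/2π` is a periodic steady state with the constant
  temperature profiles, for EVERY drive frequency `Ω`
  (`IsSteadyState.isFloquetSteadyState_prod_phaseHaar`: `T_L = T_R = T`, i.e.
  `P.IsFloquetSteadyState N Ω T 0 (ν ⊗ dφ/2π)`);
* `OscillatorChain.IsSteadyState.prod_of_frozen`: at `Ω = 0` the phase law is arbitrary —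
  `ν ⊗ m` is a periodic steady state for every probability measure `m` on the phase circle;
* `OscillatorChain.IsPeriodicSteadyState.isSteadyState_map_fst`: conversely, the phase-space
  marginal of a periodic steady state with constant temperatures is a steady state at those
  temperatures (`IsFloquetSteadyState.isSteadyState_map_fst` at `a = 0`), and the `p_i²` stay
  integrable under the marginal (`integrable_sq_map_fst`, any temperature profiles).

Proof. On `ν ⊗ m` the clock term `Ω ∂_φ f` of an admissible test function is continuous with
compact support (`continuous_phaseDeriv`, `hasCompactSupport_phaseDeriv`), hence integrable, and
it integrates to zero fibrewise over `dφ/2π` (`PhaseCircle.integral_deriv_eq_zero`); the chain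
term `L_{T_L,T_R} f(·, φ)` integrates to zero over `ν` at each frozen phase `φ`, the section
`x ↦ f (x, φ)` being an admissible test function of `IsSteadyState` (`contDiff_phaseSection`,
`hasCompactSupport_phaseSection`), so by Fubini its `ν ⊗ m`-integral vanishes when it is
integrable — and when it is not, the weak equation holds by the Bochner convention, exactly as in
`IsSteadyState` (`IsSteadyState.integral_generator_phaseSection_prod`). For the marginal,
`𝓛 (g ∘ fst) = (L g) ∘ fst` (`floquetGenerator_comp_fst`) and `g ∘ fst` is an admissible test
function on the extended phase space (the circle is compact). [folklore]
-/

section Reduction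

variable {N : ℕ}

/-- A phase section `x ↦ f (x, θ)` of a function with `C^n` lift is `C^n`. [folklore] -/
theorem contDiff_phaseSection {n : WithTop ℕ∞} {f : FloquetPhaseSpace N → ℝ}
    (hf : ContDiff ℝ n (fun y : PhaseSpace N × ℝ => f (y.1, (y.2 : PhaseCircle))))
    (θ : PhaseCircle) : ContDiff ℝ n (fun x : PhaseSpace N => f (x, θ)) := by
  obtain ⟨s, rfl⟩ := QuotientAddGroup.mk_surjective θ
  exact hf.comp (contDiff_id.prodMk contDiff_const)

/-- A phase section `x ↦ f (x, θ)` of a compactly supported function on the extended phase space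
is compactly supported (inside the projection of `tsupport f`). [folklore] -/
theorem hasCompactSupport_phaseSection {f : FloquetPhaseSpace N → ℝ} (hfc : HasCompactSupport f)
    (θ : PhaseCircle) : HasCompactSupport (fun x : PhaseSpace N => f (x, θ)) :=
  HasCompactSupport.intro (hfc.isCompact.image continuous_fst) fun x hx => by
    by_contra h
    exact hx ⟨(x, θ), subset_tsupport _ (Function.mem_support.mpr h), rfl⟩

/-- The phase derivative of a compactly supported function is compactly supported (inside
`tsupport f`: off it, `f` vanishes near the whole orbit germ `t ↦ (x, φ + t)`). [folklore] -/
theorem hasCompactSupport_phaseDeriv {f : FloquetPhaseSpace N → ℝ} (hfc : HasCompactSupport f) :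
    HasCompactSupport (phaseDeriv f) := by
  refine HasCompactSupport.intro' hfc.isCompact (isClosed_tsupport f) fun z hz => ?_
  have hz' : f =ᶠ[𝓝 z] 0 := notMem_tsupport_iff_eventuallyEq.mp hz
  have hc : Continuous fun t : ℝ => ((z.1, z.2 + (t : PhaseCircle)) : FloquetPhaseSpace N) :=
    continuous_const.prodMk (continuous_const.add QuotientAddGroup.continuous_mk)
  have h0 : Tendsto (fun t : ℝ => ((z.1, z.2 + (t : PhaseCircle)) : FloquetPhaseSpace N))
      (𝓝 0) (𝓝 z) := by
    simpa using hc.tendsto 0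
  have hev : (fun t : ℝ => f (z.1, z.2 + (t : PhaseCircle))) =ᶠ[𝓝 0] fun _ => (0 : ℝ) :=
    hz'.comp_tendsto h0
  unfold phaseDeriv
  rw [hev.deriv_eq, deriv_const]

/-- The phase derivative of a function with `C¹` lift is continuous on the extended phase space:
through the open quotient map `(x, s) ↦ (x, ↑s)` it is the partial derivative `∂_s` of the lift.
[folklore] -/
theorem continuous_phaseDeriv {f : FloquetPhaseSpace N → ℝ}
    (hf : ContDiff ℝ 1 (fun y : PhaseSpace N × ℝ => f (y.1, (y.2 : PhaseCircle)))) :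
    Continuous (phaseDeriv f) := by
  have hq : IsOpenQuotientMap
      (Prod.map id ((↑) : ℝ → PhaseCircle) : PhaseSpace N × ℝ → FloquetPhaseSpace N) :=
    IsOpenQuotientMap.id.prodMap QuotientAddGroup.isOpenQuotientMap_mk
  rw [← hq.continuous_comp_iff]
  have hcomp : phaseDeriv f ∘ Prod.map id ((↑) : ℝ → PhaseCircle) =
      fun y : PhaseSpace N × ℝ =>
        fderiv ℝ (fun y : PhaseSpace N × ℝ => f (y.1, (y.2 : PhaseCircle))) y
          ((0 : PhaseSpace N), (1 : ℝ)) := by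
    funext y
    obtain ⟨x, s⟩ := y
    show phaseDeriv f (x, (s : PhaseCircle)) = _
    rw [phaseDeriv_coe]
    have h1 : HasFDerivAt (fun y : PhaseSpace N × ℝ => f (y.1, (y.2 : PhaseCircle)))
        (fderiv ℝ (fun y : PhaseSpace N × ℝ => f (y.1, (y.2 : PhaseCircle))) (x, s)) (x, s) :=
      ((hf.differentiable one_ne_zero) (x, s)).hasFDerivAt
    have h2 : HasDerivAt (fun t : ℝ => ((x, t) : PhaseSpace N × ℝ)) ((0 : PhaseSpace N), (1 : ℝ))
        s :=
      (hasDerivAt_const s x).prodMk (hasDerivAt_id s)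
    exact (h1.comp_hasDerivAt s h2).deriv
  rw [hcomp]
  exact (hf.continuous_fderiv one_ne_zero).clm_apply continuous_const

namespace OscillatorChain

/-- The bond current `j_i` is a measurable phase-space function, whatever the interaction `V`
(`deriv V` is always measurable). [folklore] -/
theorem measurable_bondCurrent (P : OscillatorChain) (N : ℕ) (i : Fin N) :
    Measurable (P.bondCurrent N i) := by
  unfold bondCurrent
  refine Finset.measurable_sum _ fun j _ => ?_
  by_cases hj : j.val = i.val + 1
  · simp only [if_pos hj]
    fun_prop
  · simp only [if_neg hj]
    exact measurable_const

variable {P : OscillatorChain} {T_L T_R : ℝ} {ν : Measure (PhaseSpace N)}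

/-- Core of the reduction: for a steady state `ν` at `T_L, T_R` and ANY s-finite phase law `m`,
the chain part `L_{T_L,T_R} f(·, φ)` of the skew-product generator with constant temperatures
integrates to zero over `ν ⊗ m` for every admissible test function `f` of the extended phase
space — fibrewise by `IsSteadyState` (each phase section of `f` is a smooth compactly supported
observable) and Fubini when the integrand is integrable, by the Bochner convention otherwise.
[folklore] -/
theorem IsSteadyState.integral_generator_phaseSection_prod (hν : P.IsSteadyState N T_L T_R ν)
    (m : Measure PhaseCircle) [SFinite m] {f : FloquetPhaseSpace N → ℝ}
    (hf : ContDiff ℝ ∞ (fun y : PhaseSpace N × ℝ => f (y.1, (y.2 : PhaseCircle))))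
    (hfc : HasCompactSupport f) :
    ∫ z, P.generator N T_L T_R (fun x => f (x, z.2)) z.1 ∂(ν.prod m) = 0 := by
  haveI := hν.1
  by_cases hB : Integrable
      (fun z : FloquetPhaseSpace N => P.generator N T_L T_R (fun x => f (x, z.2)) z.1) (ν.prod m)
  · rw [integral_prod_symm _ hB]
    have h0 : ∀ θ : PhaseCircle, ∫ x, P.generator N T_L T_R (fun x' => f (x', θ)) x ∂ν = 0 :=
      fun θ => hν.2.1 _ (contDiff_phaseSection hf θ) (hasCompactSupport_phaseSection hfc θ)
    simp [h0]
  · exact integral_undef hB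

/-- **Steady state ⊗ uniform phase is a periodic steady state, for every drive frequency.**
If `ν` is a steady state of the `N`-chain at `T_L, T_R` under which the kinetic temperatures
`p_i²` are integrable, then for every `Ω` the product `ν ⊗ dφ/2π` is a periodic (Floquet) steady
state of the chain with the constant temperature profiles `T_L, T_R`: the clock term `Ω ∂_φ f`
integrates to zero over the uniform phase (FTC on the circle) and the chain term fibrewise over
`ν`. The `a = 0` consistency of `IsPeriodicSteadyState` with `IsSteadyState`. [folklore] -/
theorem IsSteadyState.prod_phaseHaar (hν : P.IsSteadyState N T_L T_R ν)
    (hp : ∀ i : Fin N, Integrable (fun x : PhaseSpace N => x.2 i ^ 2) ν) (Ω : ℝ) :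
    P.IsPeriodicSteadyState N Ω (fun _ => T_L) (fun _ => T_R) (ν.prod phaseHaar) := by
  haveI := hν.1
  refine ⟨inferInstance, fun f hf hfc => ?_, fun i => (hν.2.2 i).comp_fst phaseHaar,
    fun i => (hp i).comp_fst phaseHaar⟩
  have hAi : Integrable (fun z : FloquetPhaseSpace N => Ω * phaseDeriv f z) (ν.prod phaseHaar) :=
    ((continuous_phaseDeriv (hf.of_le (by norm_cast))).integrable_of_hasCompactSupport
      (hasCompactSupport_phaseDeriv hfc)).const_mul Ω
  have hA0 : ∫ z, Ω * phaseDeriv f z ∂(ν.prod phaseHaar) = 0 := by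
    rw [integral_prod _ hAi]
    have h1 : ∀ x : PhaseSpace N, ∫ θ, Ω * phaseDeriv f (x, θ) ∂phaseHaar = 0 := by
      intro x
      have hf1 : ContDiff ℝ 1 (fun s : ℝ => f (x, (s : PhaseCircle))) :=
        (hf.of_le (by norm_cast)).comp (contDiff_const.prodMk contDiff_id)
      have key := PhaseCircle.integral_deriv_eq_zero (g := fun θ => f (x, θ)) hf1
      rw [integral_const_mul]
      simp only [phaseDeriv]
      rw [key, mul_zero]
    simp [h1]
  by_cases hB : Integrable
      (fun z : FloquetPhaseSpace N => P.generator N T_L T_R (fun x => f (x, z.2)) z.1)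
      (ν.prod phaseHaar)
  · simp only [floquetGenerator]
    rw [integral_add hAi hB, hA0, zero_add]
    exact hν.integral_generator_phaseSection_prod phaseHaar hf hfc
  · simp only [floquetGenerator]
    refine integral_undef fun hG => hB ?_
    exact (hG.sub hAi).congr (Eventually.of_forall fun z => by simp)

/-- The requested special case: a steady state `ν` at equal temperatures `T, T` with the `p_i²`
integrable gives, for every drive frequency `Ω`, the zero-amplitude Floquet state `ν ⊗ dφ/2π`:
`P.IsFloquetSteadyState N Ω T 0 (ν ⊗ dφ/2π)`. [folklore] -/
theorem IsSteadyState.isFloquetSteadyState_prod_phaseHaar {T : ℝ} (hν : P.IsSteadyState N T T ν)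
    (hp : ∀ i : Fin N, Integrable (fun x : PhaseSpace N => x.2 i ^ 2) ν) (Ω : ℝ) :
    P.IsFloquetSteadyState N Ω T 0 (ν.prod phaseHaar) :=
  (P.isFloquetSteadyState_zero_iff N Ω T _).mpr (hν.prod_phaseHaar hp Ω)

/-- **Frozen phase (`Ω = 0`).** Without the clock term the phase is a mere parameter: for a
steady state `ν` at `T_L, T_R` (with the `p_i²` integrable) and ANY probability law `m` of the
phase, `ν ⊗ m` is a periodic steady state at `Ω = 0` with the constant temperature profiles.
[folklore] -/
theorem IsSteadyState.prod_of_frozen (hν : P.IsSteadyState N T_L T_R ν)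
    (hp : ∀ i : Fin N, Integrable (fun x : PhaseSpace N => x.2 i ^ 2) ν)
    (m : Measure PhaseCircle) [IsProbabilityMeasure m] :
    P.IsPeriodicSteadyState N 0 (fun _ => T_L) (fun _ => T_R) (ν.prod m) := by
  haveI := hν.1
  refine ⟨inferInstance, fun f hf hfc => ?_, fun i => (hν.2.2 i).comp_fst m,
    fun i => (hp i).comp_fst m⟩
  simp only [floquetGenerator, zero_mul, zero_add]
  exact hν.integral_generator_phaseSection_prod m hf hfc

variable {Ω : ℝ} {μ : Measure (FloquetPhaseSpace N)}

/-- The bond currents stay integrable under the phase-space marginal of a periodic steady state.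
[folklore] -/
theorem IsPeriodicSteadyState.integrable_bondCurrent_map_fst {T_L T_R : PhaseCircle → ℝ}
    (h : P.IsPeriodicSteadyState N Ω T_L T_R μ) (i : Fin N) :
    Integrable (P.bondCurrent N i) (μ.map Prod.fst) :=
  (integrable_map_measure (P.measurable_bondCurrent N i).aestronglyMeasurable
    measurable_fst.aemeasurable).mpr (h.2.2.1 i)

/-- The kinetic temperatures `p_i²` stay integrable under the phase-space marginal of a periodic
steady state. [folklore] -/
theorem IsPeriodicSteadyState.integrable_sq_map_fst {T_L T_R : PhaseCircle → ℝ}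
    (h : P.IsPeriodicSteadyState N Ω T_L T_R μ) (i : Fin N) :
    Integrable (fun x : PhaseSpace N => x.2 i ^ 2) (μ.map Prod.fst) :=
  (integrable_map_measure
    (by fun_prop : Measurable fun x : PhaseSpace N => x.2 i ^ 2).aestronglyMeasurable
    measurable_fst.aemeasurable).mpr (h.2.2.2 i)

/-- **The phase-space marginal of a periodic steady state with constant temperatures is a steady
state.** Testing the weak equation on phase-independent observables `f (x, φ) = g x` (admissible:
the circle is compact), the clock term drops out and `𝓛 f = (L_{T_L,T_R} g) ∘ fst`
(`floquetGenerator_comp_fst`), so `∫ L g d(fst_* μ) = ∫ 𝓛 f dμ = 0` (change of variables when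
`L g` is a.e.-strongly measurable, the Bochner convention otherwise). The converse direction of
the `a = 0` consistency. [folklore] -/
theorem IsPeriodicSteadyState.isSteadyState_map_fst
    (h : P.IsPeriodicSteadyState N Ω (fun _ => T_L) (fun _ => T_R) μ) :
    P.IsSteadyState N T_L T_R (μ.map Prod.fst) := by
  haveI := h.1
  haveI : Fact (0 < 2 * π) := ⟨Real.two_pi_pos⟩
  refine ⟨Measure.isProbabilityMeasure_map measurable_fst.aemeasurable, fun g hg hgc => ?_,
    h.integrable_bondCurrent_map_fst⟩
  by_cases hm : AEStronglyMeasurable (P.generator N T_L T_R g) (μ.map Prod.fst)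
  · rw [integral_map measurable_fst.aemeasurable hm]
    have hsupp : HasCompactSupport (fun z : FloquetPhaseSpace N => g z.1) := by
      refine HasCompactSupport.intro' (hgc.isCompact.prod isCompact_univ)
        ((isClosed_tsupport g).prod isClosed_univ) ?_
      rintro ⟨x, θ⟩ hx
      exact image_eq_zero_of_notMem_tsupport fun hx' => hx ⟨hx', Set.mem_univ θ⟩
    have key := h.integral_floquetGenerator (f := fun z : FloquetPhaseSpace N => g z.1)
      (hg.comp contDiff_fst) hsupp
    simpa only [floquetGenerator_comp_fst] using key
  · exact integral_non_aestronglyMeasurable hm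

/-- At zero modulation amplitude the phase-space marginal of a Floquet state is a steady state at
`T, T`. [folklore] -/
theorem IsFloquetSteadyState.isSteadyState_map_fst {T : ℝ} (h : P.IsFloquetSteadyState N Ω T 0 μ) :
    P.IsSteadyState N T T (μ.map Prod.fst) :=
  ((P.isFloquetSteadyState_zero_iff N Ω T μ).mp h).isSteadyState_map_fst

end OscillatorChain

end Reduction

end Literature.MathematicalPhysics.KineticTheory.HeatConduction
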